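import Literature.NumberTheory.ComplexMultiplication.CMTypeLattice
import Literature.AlgebraicGeometry.Motives.MumfordTateRankOfCMTypeUpperBound
import Literature.AlgebraicGeometry.Motives.HodgeTensorFactsHolds
import Literature.AlgebraicGeometry.Pohlmann1968.NondegenerateCMTypeDivisorGenerated
import HarnessLib

/-!
# The CM torus of an imaginary quadratic field: the CM elliptic curves `ℂ/Φ(𝔞)`, their Hodge structure
# and Mumford–Tate torus (Layer-A validation instances, `g = 1`)

The `g = 1` ("classical") case of Shimura's construction of abelian varieties of CM type (Shimura,
*Abelian Varieties with Complex Multiplication and Modular Functions* (1998) §6.2 Thms 3–4, the torus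
`ℂⁿ/D(𝔪)`; §4.4 / §8.4 (1): "In the classical case, F is an imaginary quadratic field") and of
Deligne's description of the Mumford–Tate group of a CM Hodge structure (LNM 900, Ex. 3.7), obtained by
SPECIALISING the tree's general theorems to `[K : ℚ] = 2` — the dimension counts behind the validation
instances "CM AV from a CM type `ℂ^Φ/Φ(𝔞)` … dimension = card Φ", "MT … of rank 2 (dimension count only)"
of the `lit-hodgefound` Layer-A tribunal (TRIBUNAL-A §2, A3).  Everything here is PROVED (theorems only; no
definition, no named fact).

For `K` an imaginary quadratic field — here: a CM field (`[IsCMField K]`, Mathlib) with `[K:ℚ] = 2`;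
every totally complex quadratic field is one (`CMTypeCount.isCMField_of_finrank_eq_two` of the companion
file `NumberTheory/ComplexMultiplication/CMTypeCount.lean`) — `Φ` one of its two CM types (`{φ}`, `{φ̄}`) and
`I` a fractional ideal of `K`:

* §1 the torus `ℂ^Φ/Φ(I)` (`ComplexTorus (CMTypeLattice.periodIso Φ I)`, real coordinates `ℝ^ι`,
  `ι` a `ℤ`-basis of `I`): `ℂ^Φ` is the complex line (`finrank_real_pi_eq_two`, `card_cmType_eq_one`:
  "dimension `= card Φ = 1`"), the lattice `Φ(I) ⊂ ℂ` has rank `2` (`finrank_idealLattice_eq_two`), and for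
  `I = 𝓞_K` it is `v(𝓞_K)` (`idealLattice_one_eq_integerLattice`, i.e. `ℤ[i] ⊂ ℂ` for `ℚ(i)`).  That
  **`ℂ^Φ/Φ(I)` is an abelian variety** — a CM ELLIPTIC CURVE — is the tree's
  `CMTypeLattice.isAbelianVariety_periodIso Φ I` (Shimura §6.2 Thm 3; Riemann form
  `E(v(α), v(β)) = Tr_{K/ℚ}(ζ α β̄)`, `CMTypeRiemannForm.riemannForm_cmEmbedding`), and that **`𝓞_K` acts by
  holomorphic endomorphisms, faithfully** ("End ⊗ ℚ ⊇ K") is the tree's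
  `CMTypeLattice.contMDiff_mapMatrix_mulMatrix` / `mulMatrixHom_injective` (Shimura §6.1 Thm 2) — both hold
  for every CM field and are not restated here;
* §2 the weight-one Hodge structure `V¹_{(K,Φ)}` (`HodgeStructure.ofCMType Φ`, Green–Griffiths–Kerr
  §V.B) has `h^{1,0} = h^{0,1} = 1` (`hodgeNumber_one_zero_eq_one`);
* §3 **its Mumford–Tate group is the rank-2 torus `Res_{K/ℚ} 𝔾_m`**, as a dimension count:
  `mtRank_ofCMType_eq_two : dim MT(V¹_{(K,Φ)}) = 2 = n + 1` (Deligne Ex. 3.7 (c) via the tree's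
  `mtRank_ofCMType_eq_cmTypeRank'` and Kubota's nondegeneracy of quadratic types,
  `Pohlmann1968.isNondegenerate_of_finrank_eq_two`); `MT(ℚ) ⊆ K^×` is the tree's
  `mumfordTateGroup_ofCMType_apply` (any number field).

The Gaussian instances `K = ℚ(i) = CyclotomicField 4 ℚ`, `Φ = {φ}`, `I = 1 = ℤ[i]` (`ℂ/ℤ[i]`) are the
one-line specialisations in the sequel `CMTorusGaussian.lean` (which also imports `CMTypeCount.lean`).

NOT here: the algebraisation `ℂ/Φ(𝔞) ≅ E(ℂ)` for a Weierstrass curve `E` (Mathlib has no uniformisation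
of elliptic curves), `End⁰ = K` exactly (needs Riemann's theorem on `H¹`, tree `ShimuraIsogenyOfRiemann`),
`j`-invariants / class fields (Shimura §4.4–§5).

## References

* [Shimura1998] G. Shimura, *Abelian Varieties with Complex Multiplication and Modular Functions* (1998),
  §6.1 Thm 2 (p. 41), §6.2 Thms 3–4 (pp. 42–45), §8.4 Example (1), §15.4 (1).
* [Deligne1982HodgeCycles] P. Deligne, *Hodge cycles on abelian varieties*, LNM 900 (1982), I Ex. 3.7.
* [Kubota1965] T. Kubota, *On the field extension by complex multiplication*, Trans. AMS 118 (1965), §2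
  (via the tree's `Pohlmann1968.isNondegenerate_of_finrank_eq_two`).
* [GreenGriffithsKerr2012] M. Green, P. Griffiths, M. Kerr, *Mumford–Tate Groups and Domains* (2012), §V.B.

## Provenance

Lane `lit-hodgefound` (Hodge path, Track 2), Layer-A skeleton seat `lit-hodgefound-skel-3`, validation rows
V6–V8 of `HOME/lit-hodgefound-skel-3/SKELETON-A3.md` (generic half; theorems only).
-/

noncomputable section

open scoped Classical nonZeroDivisors
open NumberField NumberField.InfinitePlace NumberField.ComplexEmbedding Module

namespace Literature.AlgebraicGeometry.ComplexMultiplication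

open Literature.AlgebraicGeometry.Motives (CMType HodgeTensorFacts hodgeTensorFacts_holds)
open Literature.AlgebraicGeometry.Motives.HodgeStructure (ofCMType hodgeNumber_one_zero_ofCMType
  mtRank_ofCMType_eq_cmTypeRank')
open Literature.NumberTheory.ComplexMultiplication

namespace CMTorusImaginaryQuadratic

variable {K : Type} [Field K] [NumberField K]

/-! ## §1 The torus `ℂ^Φ/Φ(I)` of an imaginary quadratic field is a CM elliptic curve -/

section Torus

variable (h2 : finrank ℚ K = 2)
include h2

/-- `#Φ = 1` for a CM type of an imaginary quadratic field ("dimension `= card Φ`" `= [K:ℚ]/2 = 1`).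
[cite: Shimura1998, §6.1 Thm. 2, p. 41] -/
theorem card_cmType_eq_one (Φ : CMType K) : Fintype.card Φ.1 = 1 := by
  have h := CMTypeLattice.two_mul_card_eq_finrank Φ
  omega

/-- `ℂ^Φ` is the complex line: `dim_ℝ ℂ^Φ = [K:ℚ] = 2`. [cite: Shimura1998, §6.2, proof of Thm. 3, p. 42] -/
theorem finrank_real_pi_eq_two (Φ : CMType K) : finrank ℝ (Φ.1 → ℂ) = 2 := by
  rw [CMTypeLattice.finrank_real_pi, h2]

/-- The lattice `Φ(I) ⊂ ℂ^Φ = ℂ` has `ℤ`-rank `2` ("`D(𝔪)` is a discrete subgroup of `ℂⁿ` of rank `2n`",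
`n = 1`). [cite: Shimura1998, §6.2, proof of Thm. 3, p. 42] -/
theorem finrank_idealLattice_eq_two (Φ : CMType K) (I : (FractionalIdeal (𝓞 K)⁰ K)ˣ) :
    finrank ℤ (CMTypeLattice.idealLattice Φ I) = 2 := by
  rw [CMTypeLattice.finrank_idealLattice, h2]

omit h2 in
/-- For the unit ideal the lattice `Φ(1)` is `v(𝓞_K)` (for `ℚ(i)`: `ℤ[i] ⊂ ℂ`).
[cite: Shimura1998, §6.2 Thm. 4, p. 45] -/
theorem idealLattice_one_eq_integerLattice (Φ : CMType K) :
    CMTypeLattice.idealLattice Φ 1 = CMTypeLattice.integerLattice Φ := by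
  ext x
  rw [CMTypeLattice.mem_idealLattice_iff, CMTypeLattice.mem_integerLattice_iff]
  constructor
  · rintro ⟨β, hβ, rfl⟩
    rw [Units.val_one, SetLike.mem_coe, FractionalIdeal.mem_one_iff] at hβ
    obtain ⟨b, rfl⟩ := hβ
    exact ⟨b, rfl⟩
  · rintro ⟨b, rfl⟩
    exact ⟨(b : K), by rw [Units.val_one, SetLike.mem_coe, FractionalIdeal.mem_one_iff]; exact ⟨b, rfl⟩, rfl⟩

end Torus

/-! ## §2 The Hodge structure `V¹_{(K,Φ)}`: `h^{1,0} = 1` -/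

section Hodge

variable (h2 : finrank ℚ K = 2)
include h2

/-- **`h^{1,0}(V¹_{(K,Φ)}) = 1`** for an imaginary quadratic `K` (`= #Φ = [K:ℚ]/2`).
[cite: GreenGriffithsKerr2012, §V.B–V.C] -/
theorem hodgeNumber_one_zero_eq_one (Φ : CMType K) : (ofCMType Φ).hodgeNumber 1 0 = 1 := by
  rw [hodgeNumber_one_zero_ofCMType, h2]

end Hodge

/-! ## §3 The Mumford–Tate group: the rank-2 torus `Res_{K/ℚ} 𝔾_m` -/

section MumfordTate

variable [IsCMField K] (h2 : finrank ℚ K = 2)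
include h2

/-- A CM type of an imaginary quadratic field is nondegenerate: `Rank(Φ) = n + 1 = 2` (Kubota; the
tree's `Pohlmann1968.isNondegenerate_of_finrank_eq_two`). [cite: Kubota1965, §2 (p. 115)] -/
theorem cmTypeRank_eq_two (Φ : CMType K) : Pohlmann1968.cmTypeRank Φ = 2 := by
  rw [(Pohlmann1968.isNondegenerate_iff Φ).mp (Pohlmann1968.isNondegenerate_of_finrank_eq_two Φ h2), h2]

/-- **`dim MT(V¹_{(K,Φ)}) = 2` for an imaginary quadratic `K`**: the Mumford–Tate group of the CM Hodge
structure of an elliptic-curve CM type is the full rank-2 torus `Res_{K/ℚ} 𝔾_m` (dimension count: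
Deligne Ex. 3.7 (c) `dim MT = Rank(Φ)`, and `Rank(Φ) = 2`). [cite: Deligne1982HodgeCycles, I Ex. 3.7] -/
theorem mtRank_ofCMType_eq_two [HodgeTensorFacts.{0, 0}] (Φ : CMType K) : (ofCMType Φ).mtRank = 2 := by
  rw [mtRank_ofCMType_eq_cmTypeRank', cmTypeRank_eq_two h2]

/-- The same with the tensor facts discharged (`hodgeTensorFacts_holds`): an instance-free statement.
[cite: Deligne1982HodgeCycles, I Ex. 3.7] -/
theorem mtRank_ofCMType_eq_two' (Φ : CMType K) :
    @Motives.HodgeStructure.mtRank K _ _ hodgeTensorFacts_holds.{0, 0} _ 1 (ofCMType Φ) = 2 := by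
  haveI : HodgeTensorFacts.{0, 0} := hodgeTensorFacts_holds.{0, 0}
  exact mtRank_ofCMType_eq_two h2 Φ

end MumfordTate

end CMTorusImaginaryQuadratic

end Literature.AlgebraicGeometry.ComplexMultiplication

end
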